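import Literature.Computability.AlgebraicComplexity.DIP20MultiplicityObstructions
import HarnessLib

/-!
# `mult_χ k[Z̄] = dim h(HWV_χ)` for a pullback `h` with kernel `I(Z)` — programme #6, brick B2

Topic `Computability/AlgebraicComplexity`; namespace `Literature.Computability.AlgebraicComplexity`.
Theorem-only file (no definitions, no named facts), brick **B2** of the `val-lit` programme #6
(`chowReciprocity`, architect's note `HOME/bip/NOTE-p7g5-chowReciprocity-discharge-sizing.md` §3; lead-bip
RULING #33 «B2 t01 GO»).

The tree's NUMERICAL multiplicity `coordRingMultiplicity k Z n χ = a_χ − dim_k (HWV_χ(k[Sym^n k^σ]) ∩ I(Z))`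
(`DIP20MultiplicityObstructions` :187; `a_χ = plethysmCoeff k σ n χ = dim_k HWV_χ(k[Sym^n])` BY DEFINITION) is,
for every `k`-linear map `h` out of `k[Sym^n k^σ] = MvPolynomial (DegIdx σ n) k` whose kernel is exactly the
vanishing ideal `I(Z)` («Hadamard kernel»), the dimension of the IMAGE of the highest-weight space:
**`coordRingMultiplicity k Z n χ = dim_k h(HWV_χ)`** (`coordRingMultiplicity_eq_finrank_map_of_ker_eq`) —
rank–nullity for `h|_{HWV_χ}` on the finite-dimensional `HWV_χ` (characteristic zero, `n ≠ 0`: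
`finiteDimensional_highestWeightSpace_coordRep_holds`, "a weight pins the degree"). Instances:

* the comorphism of the parametrisation of DIP's Chow set `Ch_N^n`, in the tree's §H form
  `aeval (fun e => coeff e.1 (genericChowProduct N n)) : k[Sym^n k^N] →ₐ k[Y_{ij}]` ((form, variable) index
  order), whose kernel is `I(Ch_N^n)` by `vanishingIdeal_chowSet_eq_ker` —
  **`coordRingMultiplicity_chowSet_eq_finrank_map_genericChow`**; the programme's `chowPullbackGen N n` (A1,
  `ChowPullbackGeneral.lean`, (variable, form) order) is the same map up to `rename Prod.swap`, and its instance
  is the one-liner `coordRingMultiplicity_eq_finrank_map_of_forall_eq_zero_iff hn χ _ chowPullbackGen_eq_zero_iff`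
  once A1 lands (A1's posted signature `chowPullbackGen_eq_zero_iff [Infinite k] : chowPullbackGen N n F = 0 ↔
  F ∈ vanishingIdeal k (formCoeff n '' chowSet k N n)` is exactly the hypothesis shape used here);
* any ring/algebra map with `RingHom.ker h = I(Z)` (`…_of_ringHom_ker_eq`).

This is DIP 2020 §5, (5.3)–(5.4) read through the pullback: "`mult_λ(W) = dim HWV_λ(W)`" for
`W = ℂ[Ch_m^n]_d ≅ k[Sym^n]/I(Ch)`, and `HWV_λ(ℂ[𝔸]_d) ↠ HWV_λ(ℂ[Ch]_d)` with kernel the highest-weight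
vectors in `I(Ch)` (arXiv p. 13); Landsberg 2017, §9.1.2 (the pullback to `k[Mat]` realises `ℂ[Ĉh]`).
[cite: DorflerIkenmeyerPanova2020, §5 eq. (5.3)–(5.4) (arXiv p. 13)]

## References

* J. Dörfler, C. Ikenmeyer, G. Panova, *On geometric complexity theory: multiplicity obstructions are
  stronger than occurrence obstructions*, SIAM J. Appl. Algebra Geom. 4 (2020) = arXiv:1901.04576, §5
  (5.3)–(5.4). [DorflerIkenmeyerPanova2020]
* J. M. Landsberg, *Geometry and Complexity Theory*, CUP 2017, §9.1.2. [Landsberg2017]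
-/

noncomputable section

open MvPolynomial Module

namespace Literature.Computability.AlgebraicComplexity

open _root_.Literature.NumberTheory.DiophantineGeometry

universe v

variable {k : Type} [Field k] {σ : Type} [Fintype σ] [LinearOrder σ]

/-- **Brick B2, generic form: `mult_χ k[Z̄] = dim_k h(HWV_χ)`** for every `k`-linear map `h` out of
`k[Sym^n k^σ]` with `h F = 0 ↔ F ∈ I(Z)` (Hadamard-kernel shape), `n ≠ 0`, characteristic zero — rank–nullity
for `h` restricted to the finite-dimensional highest-weight space `HWV_χ`, and
`coordRingMultiplicity = dim HWV_χ − dim (HWV_χ ∩ I(Z))` by definition.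
[cite: DorflerIkenmeyerPanova2020, §5 eq. (5.3)–(5.4) (arXiv p. 13)] -/
theorem coordRingMultiplicity_eq_finrank_map_of_forall_eq_zero_iff [CharZero k]
    {Z : Set (MvPolynomial σ k)} {n : ℕ} (hn : n ≠ 0) (χ : Weight σ)
    {P : Type v} [AddCommGroup P] [Module k P] (h : MvPolynomial (DegIdx σ n) k →ₗ[k] P)
    (hker : ∀ F, h F = 0 ↔ F ∈ MvPolynomial.vanishingIdeal k (formCoeff n '' Z)) :
    coordRingMultiplicity k Z n χ =
      Module.finrank k ↥((highestWeightSpace (coordRep σ k n) χ).map h) := by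
  haveI : FiniteDimensional k ↥(highestWeightSpace (coordRep σ k n) χ) :=
    finiteDimensional_highestWeightSpace_coordRep_holds hn χ
  set H := highestWeightSpace (coordRep σ k n) χ with hH
  have hdef : coordRingMultiplicity k Z n χ = Module.finrank k ↥H -
      Module.finrank k ↥(H ⊓ (MvPolynomial.vanishingIdeal k (formCoeff n '' Z)).restrictScalars k) := rfl
  have hK : H ⊓ (MvPolynomial.vanishingIdeal k (formCoeff n '' Z)).restrictScalars k =
      H ⊓ LinearMap.ker h := by
    congr 1
    ext F
    simp only [Submodule.restrictScalars_mem, LinearMap.mem_ker]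
    exact (hker F).symm
  have hrn := LinearMap.finrank_range_add_finrank_ker (h.domRestrict H)
  rw [LinearMap.range_domRestrict, LinearMap.ker_domRestrict, ← Submodule.finrank_map_subtype_eq,
    Submodule.map_comap_subtype] at hrn
  rw [hdef, hK]
  omega

/-- **Brick B2 for a ring map with `ker h = I(Z)`** (e.g. the comorphism of a dominant parametrisation of `Z`):
`mult_χ k[Z̄] = dim_k h(HWV_χ)`. [cite: DorflerIkenmeyerPanova2020, §5 eq. (5.3)–(5.4) (arXiv p. 13)] -/
theorem coordRingMultiplicity_eq_finrank_map_of_ringHom_ker_eq [CharZero k]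
    {Z : Set (MvPolynomial σ k)} {n : ℕ} (hn : n ≠ 0) (χ : Weight σ)
    {B : Type v} [CommRing B] [Algebra k B] (h : MvPolynomial (DegIdx σ n) k →ₐ[k] B)
    (hker : RingHom.ker h = MvPolynomial.vanishingIdeal k (formCoeff n '' Z)) :
    coordRingMultiplicity k Z n χ =
      Module.finrank k ↥((highestWeightSpace (coordRep σ k n) χ).map h.toLinearMap) :=
  coordRingMultiplicity_eq_finrank_map_of_forall_eq_zero_iff hn χ h.toLinearMap fun F => by
    rw [← hker, RingHom.mem_ker]
    rfl

/-- **Brick B2 for DIP's Chow set `Ch_N^n`**, against the tree's §H comorphism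
`X_e ↦ coeff_e (∏_i ∑_j Y_{ij} x_j)` (`genericChowProduct`, (form, variable) order; its kernel is `I(Ch_N^n)` by
`vanishingIdeal_chowSet_eq_ker`): **`mult_χ k[Ch_N^n] = dim_k h_{N,n}(HWV_χ)`**, `n ≠ 0`, characteristic zero.
The programme's `chowPullbackGen N n` (A1) is this map up to `rename Prod.swap`.
[cite: DorflerIkenmeyerPanova2020, §5 eq. (5.3)–(5.4) (arXiv p. 13)] -/
theorem coordRingMultiplicity_chowSet_eq_finrank_map_genericChow [CharZero k] (N : ℕ) {n : ℕ}
    (hn : n ≠ 0) (χ : Weight (Fin N)) :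
    coordRingMultiplicity k (chowSet k N n) n χ =
      Module.finrank k ↥((highestWeightSpace (coordRep (Fin N) k n) χ).map
        (aeval (fun e : DegIdx (Fin N) n => coeff e.1 (genericChowProduct (k := k) N n)) :
          MvPolynomial (DegIdx (Fin N) n) k →ₐ[k] MvPolynomial (Fin n × Fin N) k).toLinearMap) := by
  haveI : Infinite k := CharZero.infinite k
  exact coordRingMultiplicity_eq_finrank_map_of_ringHom_ker_eq hn χ _ (vanishingIdeal_chowSet_eq_ker N n).symm

/-- **Positivity through the image**: `0 < mult_χ k[Z̄] ↔ h(HWV_χ) ≠ 0` for any `h` with Hadamard kernel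
(the form in which A4 consumes a single non-vanishing pulled-back highest-weight vector).
[cite: DorflerIkenmeyerPanova2020, §5 (arXiv p. 13)] -/
theorem coordRingMultiplicity_pos_iff_map_ne_bot [CharZero k]
    {Z : Set (MvPolynomial σ k)} {n : ℕ} (hn : n ≠ 0) (χ : Weight σ)
    {P : Type v} [AddCommGroup P] [Module k P] (h : MvPolynomial (DegIdx σ n) k →ₗ[k] P)
    (hker : ∀ F, h F = 0 ↔ F ∈ MvPolynomial.vanishingIdeal k (formCoeff n '' Z)) :
    0 < coordRingMultiplicity k Z n χ ↔ (highestWeightSpace (coordRep σ k n) χ).map h ≠ ⊥ := by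
  haveI : FiniteDimensional k ↥(highestWeightSpace (coordRep σ k n) χ) :=
    finiteDimensional_highestWeightSpace_coordRep_holds hn χ
  rw [coordRingMultiplicity_eq_finrank_map_of_forall_eq_zero_iff hn χ h hker, Module.finrank_pos_iff,
    Submodule.nontrivial_iff_ne_bot]

end Literature.Computability.AlgebraicComplexity

end
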